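import Summits.QuantumFields.BalabanUV.Beta.RowD1TelescopingBounded

/-!
# Binder row D1 — AUXILIARY EXCHANGE: two out of three among (SDF-Σ) for two one-shot auxiliaries and their bounded scheme defect
# (β sub-cell, lineage an3 = row-D1 letter supplier, gen 34, node AN3-34B; v1 = p233202; v1.2 = v1 + §3 + §4, APPEND-ONLY (v1.1 = v1 + §3 was staged, never filed); sequel BY NAME of the row owner's `RowD1TelescopingBounded` p232615)

HONEST FRAMING.  Discharging `FlowStep.BetaPertH` would make Bałaban's ultraviolet stability UNCONDITIONAL — NOT the continuum
limit, NOT Clay.  This module discharges NOTHING: it is [folklore] bookkeeping (the owner's cumulative read-out identity for two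
families, subtracted, and triangle inequalities).  Binders of row D1 for the literal of record: 2∕4 (hW, hR), unchanged; (SDF-Σ) and
`D1Rep` stay OPEN.  NOT D1, NOT `BetaPertH`, NOT continuum, NOT Clay.  HONEST DEPENDENCY: continuum YM on T⁴ ⇐ BetaPertH ∧ nine
spine estimates (0∕9 proved); BetaPertH ⇐ (D1) ∧ (D4) ∧ CAP+tail; G-an2-4 gates asym, D1 and NE2∕3∕4.

ABSOLUTE RULE.  No internally-minted statement enters as a cited fact: THEOREMS ONLY below — no definitions, no `Prop`-valued
definitions, no citation tags, no proof placeholders; no printed statement is used at all (the printed B5 propositions appear BY NAME as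
hypotheses only in the last theorem, exactly as in the owner's row END).

WHAT.  The row END of record (owner, p232615) is `D1Drift(JsRowD1Pin) ⟸ (SDF-Σ)(JsRowD1Pin, JcPin) ∧ D1Rep(JcPin)` with
(SDF-Σ)(Js, Jc) := `∃ U′, ∀ m ≥ 1, |Σ_{j ∈ Ico 1 m} secondMoment (SD Lc Js Jc j) μ ν| ≤ U′` (written INLINE throughout).  The owner's header
notes that (SDF-Σ) «is insensitive to scale-independent scheme constants (e.g. which contour system the one-shot comparison family uses)».
This file is the typed form of that sentence.  For TWO one-shot auxiliaries `Jc Jc′ : ∀ m, JetData 3 (Lc^m)` over the SAME step data `Js`,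
each with (T0)∕(T1) (`m ≥ 1`) and its base identity onto `TbalOf Lc Js 0`:
* (a) `sum_sd_sub_sum_sd`: `Σ_{Ico 1 m} secondMoment (SD … Jc j) − Σ_{Ico 1 m} secondMoment (SD … Jc′ j) = secondMoment (TshotOf Lc Jc m) − secondMoment (TshotOf Lc Jc′ m)`
  (`m ≥ 1`; the cumulative step coefficients CANCEL — the owner's `readoutDefect_eq_neg_sum_sd` for both families, subtracted);
* (b) TWO OUT OF THREE among {(SDF-Σ)(Js, Jc), (SDF-Σ)(Js, Jc′), bounded SCHEME DEFECT `∃ B, ∀ m ≥ 1, |secondMoment (TshotOf Lc Jc m) μ ν −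
  secondMoment (TshotOf Lc Jc′ m) μ ν| ≤ B`}: `sdSumBdd_of_exchange`, `schemeDefectBdd_of_sdSumBdd_pair` (and the exact variant
  `sdSumBdd_of_exchange_sdInvisible` with (SDF) for `Jc′`);
* (c) at the literal of record (`Js := JsRowD1Pin hLc N`, `Jc := JcPin hLc N`, data from `RowD1Telescoping` §1; `Jc′` abstract): the same three, and the ROW END
  THROUGH AN EXCHANGED AUXILIARY `d1Drift_JsRowD1Pin_of_exchange_D1Rep`: (SDF-Σ) — or exact (SDF) — for `(JsRowD1Pin, Jc′)`, a bounded scheme defect of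
  `TshotOf Lc Jc′` against `TshotOf Lc (JcPin hLc N)`, and `D1Rep(JcPin)` give `D1Drift(JsRowD1Pin)` (owner's `d1Drift_JsRowD1Pin_of_sdSumBdd_D1Rep` ∘ (b)).

* (v1.2, §3 — APPEND-ONLY) PER STEP: `secondMoment_sd_sub_secondMoment_sd`: `secondMoment (SD … Jc j) − secondMoment (SD … Jc′ j) = Δ_{j+1} − Δ_j` (`j ≥ 1`;
  `Δ_m := secondMoment (TshotOf Lc Jc m) μ ν − secondMoment (TshotOf Lc Jc′ m) μ ν`; the lead's (SDA) `secondMoment_step_sd` for both families, subtracted — the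
  step coefficient AND the transported one-shot moment cancel; no base identity needed); at `j = 1` the base identities give `Δ_1 = 0`, so
  `secondMoment (SD … Jc 1) − secondMoment (SD … Jc′ 1) = Δ_2` (`secondMoment_sd_one_sub`) and, AGAINST ANY AUXILIARY TELESCOPING EXACTLY AT THE FIRST
  STEP, `secondMoment (SD … Jc 1) μ ν = Δ_2` (`secondMoment_sd_one_eq_of_exact`; literal `secondMoment_sd_JcPin_sub`, `secondMoment_sd_JcPin_one_eq_of_exact`):
  the `j = 1` instance of (SDF) for the pair of record, read against such a `Jc′`, says exactly that the one-level block-`Lc²` one-shot `(μ, ν)` moment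
  equals `Jc′`'s — the typed reading of an engine residual at `j = 1` (owner's `ENGINE-SDF-SPEC.md`); no such `Jc′` is exhibited.

* (v1.2, §4 — APPEND-ONLY) THE ROW END THROUGH THE SECOND AUXILIARY ALONE — `JcPin` and the scheme defect ABSENT: `d1Drift_JsRowD1Pin_of_auxiliary_D1Rep … (Jc′)
  h𝒯0′ h𝒯1′ hbase′ (hSB′ : (SDF-Σ)(JsRowD1Pin hLc N, Jc′)) … (hrep′ : D1Rep Lc Jc′ Nc μ ν a SL k) : D1Drift Lc (JsRowD1Pin hLc N) Nc μ ν` (the owner's GENERIC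
  `d1Drift_of_readoutBdd_D1Rep` ∘ `readoutBdd_iff_sdSumBdd` at the pair `(JsRowD1Pin hLc N, Jc′)`; exact variant `…_of_auxiliary_sdInvisible_D1Rep`).  A SOCKET for an
  alternative (e.g. composite) auxiliary carrying BOTH clauses — telescoping AND representation — on itself; it changes NOTHING of record (`JcPin` and
  `D1Rep Lc (JcPin hLc N) …` remain the row's one-shot and clause of record; whether a composite auxiliary should carry the `D1Rep` clause is the OWNER's call).

WHY (an3-g34 X-an3-29, a reading of B7 = CMP 98 pp. 29–30 (64)–(69), (77) and of the tree's definitions — not a kernel fact).  Bałaban's one-shot object at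
blocking `L^k` is BY DEFINITION the k-fold iterate of the one-step averaging, with composite (multi-level) contours; `JcPin hLc N m` is the ONE-LEVEL
direct average at block `Lc^m`.  Exact telescoping is structural for a composite auxiliary; for `JcPin` what is structural is (SDF-Σ), reached from ANY
auxiliary `Jc′` with exact∕bounded telescoping via a bounded scheme defect — this file's socket.  No composite auxiliary is constructed here.
-/

open Finset
open scoped BigOperators
open Literature.MathematicalPhysics.QuantumFieldTheory
open Literature.MathematicalPhysics.QuantumFieldTheory.Balaban1983to89
open Literature.MathematicalPhysics.QuantumFieldTheory.Balaban1983to89.Beta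
open OneStepResolventKernel (JetData)
open OneStepKernelFamily (TbalOf TshotOf D1Rep D1Drift)
open StepDriftWitness (SD SDInvisible secondMoment_step_sd absMoment₂_sd)
open B12Beta (secondMoment)
open Literature.MathematicalPhysics.QuantumFieldTheory.Balaban1983to89.Beta.VectorTailsLoc (fam kfam)
open Literature.MathematicalPhysics.QuantumFieldTheory.Balaban1983to89.Beta.VectorLegVolumeAdapter (MvE)
open Summit.QuantumFields.BalabanUV.Beta.RowD1JointEnd (JsRowD1Pin)
open Summit.QuantumFields.BalabanUV.Beta.D1BFx.FirstStepPinned (JcPin)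
open Summit.QuantumFields.BalabanUV.Beta.RowD1Telescoping (hbase_JcPin shotT0_JcPin shotT1_JcPin)
open Summit.QuantumFields.BalabanUV.Beta.RowD1TelescopingBounded (readoutDefect_eq_neg_sum_sd d1Drift_JsRowD1Pin_of_sdSumBdd_D1Rep
  readoutBdd_iff_sdSumBdd d1Drift_of_readoutBdd_D1Rep)

namespace Summit.QuantumFields.BalabanUV.Beta.RowD1AuxiliaryExchange

variable {Lc : ℕ} [NeZero Lc] {L : Type*}

/-! ## §1 Generic: two one-shot auxiliaries over the same step data -/

/-- [folklore] **(a) THE CUMULATIVE STEP DEFECTS OF TWO AUXILIARIES DIFFER BY THEIR ONE-SHOT SCHEME DEFECT** (the step coefficients cancel): under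
(T0)∕(T1) (`m ≥ 1`) and the base identities of both one-shot families, for every `m ≥ 1`,
`Σ_{j ∈ Ico 1 m} secondMoment (SD Lc Js Jc j) μ ν − Σ_{j ∈ Ico 1 m} secondMoment (SD Lc Js Jc′ j) μ ν = secondMoment (TshotOf Lc Jc m) μ ν − secondMoment (TshotOf Lc Jc′ m) μ ν`. -/
theorem sum_sd_sub_sum_sd (Js : ℕ → JetData 3 Lc) (Jc Jc' : ∀ m : ℕ, JetData 3 (Lc ^ m)) (μ ν : Fin 4)
    (h𝒯0 : ∀ m, 1 ≤ m → ∀ c e : Fin 4, HasSum (TshotOf Lc Jc m c e) 0)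
    (h𝒯1 : ∀ m, 1 ≤ m → ∀ c e ρ : Fin 4, HasSum (fun t : Fin 4 → ℤ => t ρ • TshotOf Lc Jc m c e t) 0)
    (hbase : TshotOf Lc Jc 1 = TbalOf Lc Js 0)
    (h𝒯0' : ∀ m, 1 ≤ m → ∀ c e : Fin 4, HasSum (TshotOf Lc Jc' m c e) 0)
    (h𝒯1' : ∀ m, 1 ≤ m → ∀ c e ρ : Fin 4, HasSum (fun t : Fin 4 → ℤ => t ρ • TshotOf Lc Jc' m c e t) 0)
    (hbase' : TshotOf Lc Jc' 1 = TbalOf Lc Js 0) :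
    ∀ m : ℕ, 1 ≤ m → ∑ j ∈ Ico 1 m, secondMoment (SD Lc Js Jc j) μ ν - ∑ j ∈ Ico 1 m, secondMoment (SD Lc Js Jc' j) μ ν
      = secondMoment (TshotOf Lc Jc m) μ ν - secondMoment (TshotOf Lc Jc' m) μ ν := by
  intro m hm
  have h := readoutDefect_eq_neg_sum_sd Js Jc μ ν h𝒯0 h𝒯1 hbase m hm
  have h' := readoutDefect_eq_neg_sum_sd Js Jc' μ ν h𝒯0' h𝒯1' hbase' m hm
  linarith

/-- [folklore] **(b₁) EXCHANGE: (SDF-Σ) FOR `Jc′` ∧ BOUNDED SCHEME DEFECT ⟹ (SDF-Σ) FOR `Jc`** (constant `U′ + B`).  The typed socket for a second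
(e.g. composite-contour) one-shot family: bounded — in particular exact — telescoping THERE plus a bounded one-shot scheme defect gives the
row's clause HERE. -/
theorem sdSumBdd_of_exchange (Js : ℕ → JetData 3 Lc) (Jc Jc' : ∀ m : ℕ, JetData 3 (Lc ^ m)) (μ ν : Fin 4)
    (h𝒯0 : ∀ m, 1 ≤ m → ∀ c e : Fin 4, HasSum (TshotOf Lc Jc m c e) 0)
    (h𝒯1 : ∀ m, 1 ≤ m → ∀ c e ρ : Fin 4, HasSum (fun t : Fin 4 → ℤ => t ρ • TshotOf Lc Jc m c e t) 0)
    (hbase : TshotOf Lc Jc 1 = TbalOf Lc Js 0)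
    (h𝒯0' : ∀ m, 1 ≤ m → ∀ c e : Fin 4, HasSum (TshotOf Lc Jc' m c e) 0)
    (h𝒯1' : ∀ m, 1 ≤ m → ∀ c e ρ : Fin 4, HasSum (fun t : Fin 4 → ℤ => t ρ • TshotOf Lc Jc' m c e t) 0)
    (hbase' : TshotOf Lc Jc' 1 = TbalOf Lc Js 0)
    (hSB' : ∃ U' : ℝ, ∀ m : ℕ, 1 ≤ m → |∑ j ∈ Ico 1 m, secondMoment (SD Lc Js Jc' j) μ ν| ≤ U')
    (hB : ∃ B : ℝ, ∀ m : ℕ, 1 ≤ m → |secondMoment (TshotOf Lc Jc m) μ ν - secondMoment (TshotOf Lc Jc' m) μ ν| ≤ B) :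
    ∃ U : ℝ, ∀ m : ℕ, 1 ≤ m → |∑ j ∈ Ico 1 m, secondMoment (SD Lc Js Jc j) μ ν| ≤ U := by
  obtain ⟨U', hU'⟩ := hSB'
  obtain ⟨B, hB⟩ := hB
  have hd := sum_sd_sub_sum_sd Js Jc Jc' μ ν h𝒯0 h𝒯1 hbase h𝒯0' h𝒯1' hbase'
  refine ⟨U' + B, fun m hm => ?_⟩
  have e : ∑ j ∈ Ico 1 m, secondMoment (SD Lc Js Jc j) μ ν
      = ∑ j ∈ Ico 1 m, secondMoment (SD Lc Js Jc' j) μ ν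
        + (secondMoment (TshotOf Lc Jc m) μ ν - secondMoment (TshotOf Lc Jc' m) μ ν) := by
    linarith [hd m hm]
  rw [e]
  exact (abs_add_le _ _).trans (add_le_add (hU' m hm) (hB m hm))

/-- [folklore] **(b₁′) EXCHANGE FROM EXACT TELESCOPING**: (SDF) `SDInvisible Lc Js Jc′ μ ν` for the second auxiliary and a bounded scheme defect give
(SDF-Σ) for `Jc` (constant `B`). -/
theorem sdSumBdd_of_exchange_sdInvisible (Js : ℕ → JetData 3 Lc) (Jc Jc' : ∀ m : ℕ, JetData 3 (Lc ^ m)) (μ ν : Fin 4)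
    (h𝒯0 : ∀ m, 1 ≤ m → ∀ c e : Fin 4, HasSum (TshotOf Lc Jc m c e) 0)
    (h𝒯1 : ∀ m, 1 ≤ m → ∀ c e ρ : Fin 4, HasSum (fun t : Fin 4 → ℤ => t ρ • TshotOf Lc Jc m c e t) 0)
    (hbase : TshotOf Lc Jc 1 = TbalOf Lc Js 0)
    (h𝒯0' : ∀ m, 1 ≤ m → ∀ c e : Fin 4, HasSum (TshotOf Lc Jc' m c e) 0)
    (h𝒯1' : ∀ m, 1 ≤ m → ∀ c e ρ : Fin 4, HasSum (fun t : Fin 4 → ℤ => t ρ • TshotOf Lc Jc' m c e t) 0)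
    (hbase' : TshotOf Lc Jc' 1 = TbalOf Lc Js 0)
    (hSF' : SDInvisible Lc Js Jc' μ ν)
    (hB : ∃ B : ℝ, ∀ m : ℕ, 1 ≤ m → |secondMoment (TshotOf Lc Jc m) μ ν - secondMoment (TshotOf Lc Jc' m) μ ν| ≤ B) :
    ∃ U : ℝ, ∀ m : ℕ, 1 ≤ m → |∑ j ∈ Ico 1 m, secondMoment (SD Lc Js Jc j) μ ν| ≤ U :=
  sdSumBdd_of_exchange Js Jc Jc' μ ν h𝒯0 h𝒯1 hbase h𝒯0' h𝒯1' hbase'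
    ⟨0, fun m _ => by rw [Finset.sum_eq_zero fun j hj => hSF' j (Finset.mem_Ico.1 hj).1, abs_zero]⟩ hB

/-- [folklore] **(b₂) THE THIRD DIRECTION: (SDF-Σ) FOR BOTH AUXILIARIES ⟹ BOUNDED SCHEME DEFECT** (constant `U + U′`): two one-shot families that both
telescope (up to `O(1)`) onto the same step data have `(μ, ν)` one-shot second moments within a bounded distance of each other at every scale `Lc^m`. -/
theorem schemeDefectBdd_of_sdSumBdd_pair (Js : ℕ → JetData 3 Lc) (Jc Jc' : ∀ m : ℕ, JetData 3 (Lc ^ m)) (μ ν : Fin 4)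
    (h𝒯0 : ∀ m, 1 ≤ m → ∀ c e : Fin 4, HasSum (TshotOf Lc Jc m c e) 0)
    (h𝒯1 : ∀ m, 1 ≤ m → ∀ c e ρ : Fin 4, HasSum (fun t : Fin 4 → ℤ => t ρ • TshotOf Lc Jc m c e t) 0)
    (hbase : TshotOf Lc Jc 1 = TbalOf Lc Js 0)
    (h𝒯0' : ∀ m, 1 ≤ m → ∀ c e : Fin 4, HasSum (TshotOf Lc Jc' m c e) 0)
    (h𝒯1' : ∀ m, 1 ≤ m → ∀ c e ρ : Fin 4, HasSum (fun t : Fin 4 → ℤ => t ρ • TshotOf Lc Jc' m c e t) 0)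
    (hbase' : TshotOf Lc Jc' 1 = TbalOf Lc Js 0)
    (hSB : ∃ U : ℝ, ∀ m : ℕ, 1 ≤ m → |∑ j ∈ Ico 1 m, secondMoment (SD Lc Js Jc j) μ ν| ≤ U)
    (hSB' : ∃ U' : ℝ, ∀ m : ℕ, 1 ≤ m → |∑ j ∈ Ico 1 m, secondMoment (SD Lc Js Jc' j) μ ν| ≤ U') :
    ∃ B : ℝ, ∀ m : ℕ, 1 ≤ m → |secondMoment (TshotOf Lc Jc m) μ ν - secondMoment (TshotOf Lc Jc' m) μ ν| ≤ B := by
  obtain ⟨U, hU⟩ := hSB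
  obtain ⟨U', hU'⟩ := hSB'
  have hd := sum_sd_sub_sum_sd Js Jc Jc' μ ν h𝒯0 h𝒯1 hbase h𝒯0' h𝒯1' hbase'
  refine ⟨U + U', fun m hm => ?_⟩
  rw [← hd m hm]
  exact (abs_sub _ _).trans (add_le_add (hU m hm) (hU' m hm))

/-! ## §2 The literal of record `Js := JsRowD1Pin hLc N`, `Jc := JcPin hLc N` (data from `RowD1Telescoping` §1); `Jc′` abstract -/

/-- [folklore] **(a) AT THE LITERAL**: for any second auxiliary `Jc′` with (T0)∕(T1) (`m ≥ 1`) and base identity onto the literal's first step, for every `m ≥ 1`,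
`Σ_{Ico 1 m} secondMoment (SD Lc (JsRowD1Pin hLc N) (JcPin hLc N) j) μ ν − Σ_{Ico 1 m} secondMoment (SD Lc (JsRowD1Pin hLc N) Jc′ j) μ ν
  = secondMoment (TshotOf Lc (JcPin hLc N) m) μ ν − secondMoment (TshotOf Lc Jc′ m) μ ν`. -/
theorem sum_sd_JcPin_sub_sum_sd (hLc : Odd Lc) {N : ℕ} (hN : 2 ≤ N) (Jc' : ∀ m : ℕ, JetData 3 (Lc ^ m)) (μ ν : Fin 4)
    (h𝒯0' : ∀ m, 1 ≤ m → ∀ c e : Fin 4, HasSum (TshotOf Lc Jc' m c e) 0)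
    (h𝒯1' : ∀ m, 1 ≤ m → ∀ c e ρ : Fin 4, HasSum (fun t : Fin 4 → ℤ => t ρ • TshotOf Lc Jc' m c e t) 0)
    (hbase' : TshotOf Lc Jc' 1 = TbalOf Lc (JsRowD1Pin hLc N) 0) :
    ∀ m : ℕ, 1 ≤ m → ∑ j ∈ Ico 1 m, secondMoment (SD Lc (JsRowD1Pin hLc N) (JcPin hLc N) j) μ ν
        - ∑ j ∈ Ico 1 m, secondMoment (SD Lc (JsRowD1Pin hLc N) Jc' j) μ ν
      = secondMoment (TshotOf Lc (JcPin hLc N) m) μ ν - secondMoment (TshotOf Lc Jc' m) μ ν :=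
  sum_sd_sub_sum_sd (JsRowD1Pin hLc N) (JcPin hLc N) Jc' μ ν (shotT0_JcPin hLc hN) (shotT1_JcPin hLc hN) (hbase_JcPin hLc N)
    h𝒯0' h𝒯1' hbase'

/-- [folklore] **(b₁) AT THE LITERAL — (SDF-Σ) FOR THE PAIR OF RECORD FROM AN EXCHANGED AUXILIARY**: (SDF-Σ) for `(JsRowD1Pin hLc N, Jc′)` and a bounded scheme
defect of `TshotOf Lc (JcPin hLc N)` against `TshotOf Lc Jc′` give (SDF-Σ) for `(JsRowD1Pin hLc N, JcPin hLc N)` — the clause the row END of record consumes.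
Nothing about `Jc′` is asserted. -/
theorem sdSumBdd_JsRowD1Pin_JcPin_of_exchange (hLc : Odd Lc) {N : ℕ} (hN : 2 ≤ N) (Jc' : ∀ m : ℕ, JetData 3 (Lc ^ m)) (μ ν : Fin 4)
    (h𝒯0' : ∀ m, 1 ≤ m → ∀ c e : Fin 4, HasSum (TshotOf Lc Jc' m c e) 0)
    (h𝒯1' : ∀ m, 1 ≤ m → ∀ c e ρ : Fin 4, HasSum (fun t : Fin 4 → ℤ => t ρ • TshotOf Lc Jc' m c e t) 0)
    (hbase' : TshotOf Lc Jc' 1 = TbalOf Lc (JsRowD1Pin hLc N) 0)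
    (hSB' : ∃ U' : ℝ, ∀ m : ℕ, 1 ≤ m → |∑ j ∈ Ico 1 m, secondMoment (SD Lc (JsRowD1Pin hLc N) Jc' j) μ ν| ≤ U')
    (hB : ∃ B : ℝ, ∀ m : ℕ, 1 ≤ m →
      |secondMoment (TshotOf Lc (JcPin hLc N) m) μ ν - secondMoment (TshotOf Lc Jc' m) μ ν| ≤ B) :
    ∃ U : ℝ, ∀ m : ℕ, 1 ≤ m → |∑ j ∈ Ico 1 m, secondMoment (SD Lc (JsRowD1Pin hLc N) (JcPin hLc N) j) μ ν| ≤ U :=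
  sdSumBdd_of_exchange (JsRowD1Pin hLc N) (JcPin hLc N) Jc' μ ν (shotT0_JcPin hLc hN) (shotT1_JcPin hLc hN) (hbase_JcPin hLc N)
    h𝒯0' h𝒯1' hbase' hSB' hB

/-- [folklore] **(b₂) AT THE LITERAL — THE SCHEME DEFECT IS FORCED BOUNDED** once (SDF-Σ) holds for the pair of record AND for `(JsRowD1Pin hLc N, Jc′)`. -/
theorem schemeDefectBdd_JcPin_of_sdSumBdd_pair (hLc : Odd Lc) {N : ℕ} (hN : 2 ≤ N) (Jc' : ∀ m : ℕ, JetData 3 (Lc ^ m)) (μ ν : Fin 4)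
    (h𝒯0' : ∀ m, 1 ≤ m → ∀ c e : Fin 4, HasSum (TshotOf Lc Jc' m c e) 0)
    (h𝒯1' : ∀ m, 1 ≤ m → ∀ c e ρ : Fin 4, HasSum (fun t : Fin 4 → ℤ => t ρ • TshotOf Lc Jc' m c e t) 0)
    (hbase' : TshotOf Lc Jc' 1 = TbalOf Lc (JsRowD1Pin hLc N) 0)
    (hSB : ∃ U : ℝ, ∀ m : ℕ, 1 ≤ m → |∑ j ∈ Ico 1 m, secondMoment (SD Lc (JsRowD1Pin hLc N) (JcPin hLc N) j) μ ν| ≤ U)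
    (hSB' : ∃ U' : ℝ, ∀ m : ℕ, 1 ≤ m → |∑ j ∈ Ico 1 m, secondMoment (SD Lc (JsRowD1Pin hLc N) Jc' j) μ ν| ≤ U') :
    ∃ B : ℝ, ∀ m : ℕ, 1 ≤ m → |secondMoment (TshotOf Lc (JcPin hLc N) m) μ ν - secondMoment (TshotOf Lc Jc' m) μ ν| ≤ B :=
  schemeDefectBdd_of_sdSumBdd_pair (JsRowD1Pin hLc N) (JcPin hLc N) Jc' μ ν (shotT0_JcPin hLc hN) (shotT1_JcPin hLc hN) (hbase_JcPin hLc N)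
    h𝒯0' h𝒯1' hbase' hSB hSB'

/-- [folklore] **(c) THE ROW END THROUGH AN EXCHANGED AUXILIARY: `D1Drift Lc (JsRowD1Pin hLc N) Nc μ ν` ⟸ (SDF-Σ)(JsRowD1Pin, Jc′) ∧ bounded scheme defect ∧ `D1Rep(JcPin)`**
(+ the printed B5 facts `Prop12Printed`∕`Kernel126_127Printed` BY NAME, window data, `μ ≠ ν`, `Nc ≠ 0`, `2 ≤ Lc`, `2 ≤ N`; `Jc′` with (T0)∕(T1) and base identity) —
the owner's `d1Drift_JsRowD1Pin_of_sdSumBdd_D1Rep` fed by (b₁).  CONDITIONAL on exactly those; `Nc` free.  Binders 2∕4; NOT D1, NOT `BetaPertH`, NOT continuum, NOT Clay. -/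
theorem d1Drift_JsRowD1Pin_of_exchange_D1Rep (hLc : Odd Lc) (hL2 : 2 ≤ Lc) {N : ℕ} (hN : 2 ≤ N)
    (a : ℝ) (ha : 0 < a)
    (h12 : B5.Prop12Printed (fam (fun i : ℕ+ × ℕ => ((i.1 : ℕ+) : ℕ)) (fun i => i.1.pos) MvE a ha))
    (h126 : B5.Kernel126_127Printed (kfam (fun i : ℕ+ × ℕ => ((i.1 : ℕ+) : ℕ)) MvE))
    {SL : Finset L} (hSL : SL.Nonempty) (k : L → Fin 4) {μ ν : Fin 4} (hμν : μ ≠ ν) {Nc : ℝ} (hNc : Nc ≠ 0)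
    (Jc' : ∀ m : ℕ, JetData 3 (Lc ^ m))
    (h𝒯0' : ∀ m, 1 ≤ m → ∀ c e : Fin 4, HasSum (TshotOf Lc Jc' m c e) 0)
    (h𝒯1' : ∀ m, 1 ≤ m → ∀ c e ρ : Fin 4, HasSum (fun t : Fin 4 → ℤ => t ρ • TshotOf Lc Jc' m c e t) 0)
    (hbase' : TshotOf Lc Jc' 1 = TbalOf Lc (JsRowD1Pin hLc N) 0)
    (hSB' : ∃ U' : ℝ, ∀ m : ℕ, 1 ≤ m → |∑ j ∈ Ico 1 m, secondMoment (SD Lc (JsRowD1Pin hLc N) Jc' j) μ ν| ≤ U')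
    (hB : ∃ B : ℝ, ∀ m : ℕ, 1 ≤ m →
      |secondMoment (TshotOf Lc (JcPin hLc N) m) μ ν - secondMoment (TshotOf Lc Jc' m) μ ν| ≤ B)
    {cc : ℝ} {M : ℕ → ℕ} (hc : 1 ≤ cc) (hMw : ∀ L : ℕ, 2 ≤ L → 1 ≤ M L ∧ (L : ℝ) ≤ cc * M L) (hML : ∀ L : ℕ, 2 ≤ L → M L ≤ L)
    (hrep : D1Rep Lc (JcPin hLc N) Nc μ ν a SL k) :
    D1Drift Lc (JsRowD1Pin hLc N) Nc μ ν :=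
  d1Drift_JsRowD1Pin_of_sdSumBdd_D1Rep hLc hL2 hN a ha h12 h126 hSL k hμν hNc
    (sdSumBdd_JsRowD1Pin_JcPin_of_exchange hLc hN Jc' μ ν h𝒯0' h𝒯1' hbase' hSB' hB) hc hMw hML hrep

/-- [folklore] **(c′) THE SAME FROM EXACT TELESCOPING ONTO THE SECOND AUXILIARY**: (SDF) `SDInvisible Lc (JsRowD1Pin hLc N) Jc′ μ ν` in place of (SDF-Σ)(JsRowD1Pin, Jc′). -/
theorem d1Drift_JsRowD1Pin_of_exchange_sdInvisible_D1Rep (hLc : Odd Lc) (hL2 : 2 ≤ Lc) {N : ℕ} (hN : 2 ≤ N)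
    (a : ℝ) (ha : 0 < a)
    (h12 : B5.Prop12Printed (fam (fun i : ℕ+ × ℕ => ((i.1 : ℕ+) : ℕ)) (fun i => i.1.pos) MvE a ha))
    (h126 : B5.Kernel126_127Printed (kfam (fun i : ℕ+ × ℕ => ((i.1 : ℕ+) : ℕ)) MvE))
    {SL : Finset L} (hSL : SL.Nonempty) (k : L → Fin 4) {μ ν : Fin 4} (hμν : μ ≠ ν) {Nc : ℝ} (hNc : Nc ≠ 0)
    (Jc' : ∀ m : ℕ, JetData 3 (Lc ^ m))
    (h𝒯0' : ∀ m, 1 ≤ m → ∀ c e : Fin 4, HasSum (TshotOf Lc Jc' m c e) 0)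
    (h𝒯1' : ∀ m, 1 ≤ m → ∀ c e ρ : Fin 4, HasSum (fun t : Fin 4 → ℤ => t ρ • TshotOf Lc Jc' m c e t) 0)
    (hbase' : TshotOf Lc Jc' 1 = TbalOf Lc (JsRowD1Pin hLc N) 0)
    (hSF' : SDInvisible Lc (JsRowD1Pin hLc N) Jc' μ ν)
    (hB : ∃ B : ℝ, ∀ m : ℕ, 1 ≤ m →
      |secondMoment (TshotOf Lc (JcPin hLc N) m) μ ν - secondMoment (TshotOf Lc Jc' m) μ ν| ≤ B)
    {cc : ℝ} {M : ℕ → ℕ} (hc : 1 ≤ cc) (hMw : ∀ L : ℕ, 2 ≤ L → 1 ≤ M L ∧ (L : ℝ) ≤ cc * M L) (hML : ∀ L : ℕ, 2 ≤ L → M L ≤ L)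
    (hrep : D1Rep Lc (JcPin hLc N) Nc μ ν a SL k) :
    D1Drift Lc (JsRowD1Pin hLc N) Nc μ ν :=
  d1Drift_JsRowD1Pin_of_exchange_D1Rep hLc hL2 hN a ha h12 h126 hSL k hμν hNc Jc' h𝒯0' h𝒯1' hbase'
    ⟨0, fun m _ => by rw [Finset.sum_eq_zero fun j hj => hSF' j (Finset.mem_Ico.1 hj).1, abs_zero]⟩ hB hc hMw hML hrep


/-! ## §3 (v1.2, APPEND-ONLY) Per-step exchange and the first-step reading — generic, then at the literal of record -/

/-- [folklore] **(a₀) PER-STEP EXCHANGE IDENTITY**: under (T0)∕(T1) (`m ≥ 1`) of both one-shot families (no base identity needed), for every `j ≥ 1`,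
`secondMoment (SD Lc Js Jc j) μ ν − secondMoment (SD Lc Js Jc′ j) μ ν = Δ_{j+1} − Δ_j`, `Δ_m := secondMoment (TshotOf Lc Jc m) μ ν − secondMoment (TshotOf Lc Jc′ m) μ ν`
— the lead's (SDA) `secondMoment_step_sd` for both families, subtracted (the step coefficient `secondMoment (TbalOf Lc Js j) μ ν` cancels). -/
theorem secondMoment_sd_sub_secondMoment_sd (Js : ℕ → JetData 3 Lc) (Jc Jc' : ∀ m : ℕ, JetData 3 (Lc ^ m)) (μ ν : Fin 4)
    (h𝒯0 : ∀ m, 1 ≤ m → ∀ c e : Fin 4, HasSum (TshotOf Lc Jc m c e) 0)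
    (h𝒯1 : ∀ m, 1 ≤ m → ∀ c e ρ : Fin 4, HasSum (fun t : Fin 4 → ℤ => t ρ • TshotOf Lc Jc m c e t) 0)
    (h𝒯0' : ∀ m, 1 ≤ m → ∀ c e : Fin 4, HasSum (TshotOf Lc Jc' m c e) 0)
    (h𝒯1' : ∀ m, 1 ≤ m → ∀ c e ρ : Fin 4, HasSum (fun t : Fin 4 → ℤ => t ρ • TshotOf Lc Jc' m c e t) 0) :
    ∀ j : ℕ, 1 ≤ j → secondMoment (SD Lc Js Jc j) μ ν - secondMoment (SD Lc Js Jc' j) μ ν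
      = (secondMoment (TshotOf Lc Jc (j + 1)) μ ν - secondMoment (TshotOf Lc Jc' (j + 1)) μ ν)
        - (secondMoment (TshotOf Lc Jc j) μ ν - secondMoment (TshotOf Lc Jc' j) μ ν) := by
  intro j hj
  have h := secondMoment_step_sd Js Jc μ ν h𝒯0 h𝒯1 (fun j _ c e => absMoment₂_sd Js Jc j c e) j hj
  have h' := secondMoment_step_sd Js Jc' μ ν h𝒯0' h𝒯1' (fun j _ c e => absMoment₂_sd Js Jc' j c e) j hj
  linarith

/-- [folklore] **(a₁) AT THE FIRST STEP THE DEFECT DIFFERENCE IS THE SCHEME DIFFERENCE AT BLOCK `Lc²`**: with both base identities (`Δ_1 = 0`),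
`secondMoment (SD Lc Js Jc 1) μ ν − secondMoment (SD Lc Js Jc′ 1) μ ν = secondMoment (TshotOf Lc Jc 2) μ ν − secondMoment (TshotOf Lc Jc′ 2) μ ν`. -/
theorem secondMoment_sd_one_sub (Js : ℕ → JetData 3 Lc) (Jc Jc' : ∀ m : ℕ, JetData 3 (Lc ^ m)) (μ ν : Fin 4)
    (h𝒯0 : ∀ m, 1 ≤ m → ∀ c e : Fin 4, HasSum (TshotOf Lc Jc m c e) 0)
    (h𝒯1 : ∀ m, 1 ≤ m → ∀ c e ρ : Fin 4, HasSum (fun t : Fin 4 → ℤ => t ρ • TshotOf Lc Jc m c e t) 0)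
    (hbase : TshotOf Lc Jc 1 = TbalOf Lc Js 0)
    (h𝒯0' : ∀ m, 1 ≤ m → ∀ c e : Fin 4, HasSum (TshotOf Lc Jc' m c e) 0)
    (h𝒯1' : ∀ m, 1 ≤ m → ∀ c e ρ : Fin 4, HasSum (fun t : Fin 4 → ℤ => t ρ • TshotOf Lc Jc' m c e t) 0)
    (hbase' : TshotOf Lc Jc' 1 = TbalOf Lc Js 0) :
    secondMoment (SD Lc Js Jc 1) μ ν - secondMoment (SD Lc Js Jc' 1) μ ν
      = secondMoment (TshotOf Lc Jc 2) μ ν - secondMoment (TshotOf Lc Jc' 2) μ ν := by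
  have h := secondMoment_sd_sub_secondMoment_sd Js Jc Jc' μ ν h𝒯0 h𝒯1 h𝒯0' h𝒯1' 1 le_rfl
  rw [hbase, hbase'] at h
  simp only [Nat.reduceAdd, sub_self, sub_zero] at h
  exact h

/-- [folklore] **(a₁′) HENCE, AGAINST ANY AUXILIARY THAT TELESCOPES EXACTLY AT THE FIRST STEP** (`secondMoment (SD Lc Js Jc′ 1) μ ν = 0`), the first step
defect's `(μ, ν)` moment of `Jc` IS the one-shot scheme difference at block `Lc²`:
`secondMoment (SD Lc Js Jc 1) μ ν = secondMoment (TshotOf Lc Jc 2) μ ν − secondMoment (TshotOf Lc Jc′ 2) μ ν`.  (Typed reading of an engine residual at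
`j = 1`; NO auxiliary with this property is exhibited here.) -/
theorem secondMoment_sd_one_eq_of_exact (Js : ℕ → JetData 3 Lc) (Jc Jc' : ∀ m : ℕ, JetData 3 (Lc ^ m)) (μ ν : Fin 4)
    (h𝒯0 : ∀ m, 1 ≤ m → ∀ c e : Fin 4, HasSum (TshotOf Lc Jc m c e) 0)
    (h𝒯1 : ∀ m, 1 ≤ m → ∀ c e ρ : Fin 4, HasSum (fun t : Fin 4 → ℤ => t ρ • TshotOf Lc Jc m c e t) 0)
    (hbase : TshotOf Lc Jc 1 = TbalOf Lc Js 0)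
    (h𝒯0' : ∀ m, 1 ≤ m → ∀ c e : Fin 4, HasSum (TshotOf Lc Jc' m c e) 0)
    (h𝒯1' : ∀ m, 1 ≤ m → ∀ c e ρ : Fin 4, HasSum (fun t : Fin 4 → ℤ => t ρ • TshotOf Lc Jc' m c e t) 0)
    (hbase' : TshotOf Lc Jc' 1 = TbalOf Lc Js 0)
    (hexact : secondMoment (SD Lc Js Jc' 1) μ ν = 0) :
    secondMoment (SD Lc Js Jc 1) μ ν = secondMoment (TshotOf Lc Jc 2) μ ν - secondMoment (TshotOf Lc Jc' 2) μ ν := by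
  have h := secondMoment_sd_one_sub Js Jc Jc' μ ν h𝒯0 h𝒯1 hbase h𝒯0' h𝒯1' hbase'
  rw [hexact, sub_zero] at h
  exact h

/-- [folklore] **(a₀) AT THE LITERAL — PER-STEP EXCHANGE**: for any second auxiliary `Jc′` with (T0)∕(T1) (`m ≥ 1`), for every `j ≥ 1`,
`secondMoment (SD Lc (JsRowD1Pin hLc N) (JcPin hLc N) j) μ ν − secondMoment (SD Lc (JsRowD1Pin hLc N) Jc′ j) μ ν = Δ_{j+1} − Δ_j`,
`Δ_m := secondMoment (TshotOf Lc (JcPin hLc N) m) μ ν − secondMoment (TshotOf Lc Jc′ m) μ ν`. -/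
theorem secondMoment_sd_JcPin_sub (hLc : Odd Lc) {N : ℕ} (hN : 2 ≤ N) (Jc' : ∀ m : ℕ, JetData 3 (Lc ^ m)) (μ ν : Fin 4)
    (h𝒯0' : ∀ m, 1 ≤ m → ∀ c e : Fin 4, HasSum (TshotOf Lc Jc' m c e) 0)
    (h𝒯1' : ∀ m, 1 ≤ m → ∀ c e ρ : Fin 4, HasSum (fun t : Fin 4 → ℤ => t ρ • TshotOf Lc Jc' m c e t) 0) :
    ∀ j : ℕ, 1 ≤ j → secondMoment (SD Lc (JsRowD1Pin hLc N) (JcPin hLc N) j) μ ν - secondMoment (SD Lc (JsRowD1Pin hLc N) Jc' j) μ ν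
      = (secondMoment (TshotOf Lc (JcPin hLc N) (j + 1)) μ ν - secondMoment (TshotOf Lc Jc' (j + 1)) μ ν)
        - (secondMoment (TshotOf Lc (JcPin hLc N) j) μ ν - secondMoment (TshotOf Lc Jc' j) μ ν) :=
  secondMoment_sd_sub_secondMoment_sd (JsRowD1Pin hLc N) (JcPin hLc N) Jc' μ ν (shotT0_JcPin hLc hN) (shotT1_JcPin hLc hN) h𝒯0' h𝒯1'

/-- [folklore] **(a₁′) AT THE LITERAL — THE FIRST STEP DEFECT AGAINST AN EXACTLY TELESCOPING AUXILIARY**: if `Jc′` (with (T0)∕(T1), base identity onto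
`TbalOf Lc (JsRowD1Pin hLc N) 0`) has `secondMoment (SD Lc (JsRowD1Pin hLc N) Jc′ 1) μ ν = 0`, then
`secondMoment (SD Lc (JsRowD1Pin hLc N) (JcPin hLc N) 1) μ ν = secondMoment (TshotOf Lc (JcPin hLc N) 2) μ ν − secondMoment (TshotOf Lc Jc′ 2) μ ν` — the `j = 1`
instance of (SDF) for the pair of record, read against such a `Jc′`, is EXACTLY the statement that the one-level block-`Lc²` one-shot `(μ, ν)` moment equals
`Jc′`'s.  No such `Jc′` is exhibited; nothing about the pair of record is asserted. -/
theorem secondMoment_sd_JcPin_one_eq_of_exact (hLc : Odd Lc) {N : ℕ} (hN : 2 ≤ N) (Jc' : ∀ m : ℕ, JetData 3 (Lc ^ m)) (μ ν : Fin 4)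
    (h𝒯0' : ∀ m, 1 ≤ m → ∀ c e : Fin 4, HasSum (TshotOf Lc Jc' m c e) 0)
    (h𝒯1' : ∀ m, 1 ≤ m → ∀ c e ρ : Fin 4, HasSum (fun t : Fin 4 → ℤ => t ρ • TshotOf Lc Jc' m c e t) 0)
    (hbase' : TshotOf Lc Jc' 1 = TbalOf Lc (JsRowD1Pin hLc N) 0)
    (hexact : secondMoment (SD Lc (JsRowD1Pin hLc N) Jc' 1) μ ν = 0) :
    secondMoment (SD Lc (JsRowD1Pin hLc N) (JcPin hLc N) 1) μ ν
      = secondMoment (TshotOf Lc (JcPin hLc N) 2) μ ν - secondMoment (TshotOf Lc Jc' 2) μ ν :=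
  secondMoment_sd_one_eq_of_exact (JsRowD1Pin hLc N) (JcPin hLc N) Jc' μ ν (shotT0_JcPin hLc hN) (shotT1_JcPin hLc hN) (hbase_JcPin hLc N)
    h𝒯0' h𝒯1' hbase' hexact


/-! ## §4 (v1.2, APPEND-ONLY) The row END through the second auxiliary alone — a socket; nothing of record changes -/

/-- [folklore] **(c″) THE ROW END THROUGH THE SECOND AUXILIARY ALONE**: for ANY auxiliary `Jc′ : ∀ m, JetData 3 (Lc^m)` with (T0)∕(T1) (`m ≥ 1`) and base
identity onto `TbalOf Lc (JsRowD1Pin hLc N) 0`, (SDF-Σ) for `(JsRowD1Pin hLc N, Jc′)` and `D1Rep Lc Jc′ Nc μ ν a SL k` (+ the printed B5 facts BY NAME, window data,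
`μ ≠ ν`, `Nc ≠ 0`, `2 ≤ Lc`) give `D1Drift Lc (JsRowD1Pin hLc N) Nc μ ν` — the owner's GENERIC `d1Drift_of_readoutBdd_D1Rep` ∘ `readoutBdd_iff_sdSumBdd` at this
pair; `JcPin` and the scheme defect do not occur.  CONDITIONAL on exactly those; a socket for an alternative auxiliary, NOT a change of the row's one-shot or
clauses of record.  Binders 2∕4; NOT D1, NOT `BetaPertH`, NOT continuum, NOT Clay. -/
theorem d1Drift_JsRowD1Pin_of_auxiliary_D1Rep (hLc : Odd Lc) (hL2 : 2 ≤ Lc) (N : ℕ)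
    (a : ℝ) (ha : 0 < a)
    (h12 : B5.Prop12Printed (fam (fun i : ℕ+ × ℕ => ((i.1 : ℕ+) : ℕ)) (fun i => i.1.pos) MvE a ha))
    (h126 : B5.Kernel126_127Printed (kfam (fun i : ℕ+ × ℕ => ((i.1 : ℕ+) : ℕ)) MvE))
    {SL : Finset L} (hSL : SL.Nonempty) (k : L → Fin 4) {μ ν : Fin 4} (hμν : μ ≠ ν) {Nc : ℝ} (hNc : Nc ≠ 0)
    (Jc' : ∀ m : ℕ, JetData 3 (Lc ^ m))
    (h𝒯0' : ∀ m, 1 ≤ m → ∀ c e : Fin 4, HasSum (TshotOf Lc Jc' m c e) 0)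
    (h𝒯1' : ∀ m, 1 ≤ m → ∀ c e ρ : Fin 4, HasSum (fun t : Fin 4 → ℤ => t ρ • TshotOf Lc Jc' m c e t) 0)
    (hbase' : TshotOf Lc Jc' 1 = TbalOf Lc (JsRowD1Pin hLc N) 0)
    (hSB' : ∃ U' : ℝ, ∀ m : ℕ, 1 ≤ m → |∑ j ∈ Ico 1 m, secondMoment (SD Lc (JsRowD1Pin hLc N) Jc' j) μ ν| ≤ U')
    {cc : ℝ} {M : ℕ → ℕ} (hc : 1 ≤ cc) (hMw : ∀ L : ℕ, 2 ≤ L → 1 ≤ M L ∧ (L : ℝ) ≤ cc * M L) (hML : ∀ L : ℕ, 2 ≤ L → M L ≤ L)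
    (hrep' : D1Rep Lc Jc' Nc μ ν a SL k) :
    D1Drift Lc (JsRowD1Pin hLc N) Nc μ ν :=
  d1Drift_of_readoutBdd_D1Rep a ha h12 h126 hSL k hμν hNc hL2 (JsRowD1Pin hLc N) Jc'
    ((readoutBdd_iff_sdSumBdd (JsRowD1Pin hLc N) Jc' μ ν h𝒯0' h𝒯1' hbase').2 hSB') hc hMw hML hrep'

/-- [folklore] **(c‴) THE SAME FROM EXACT TELESCOPING ONTO THE SECOND AUXILIARY**: `SDInvisible Lc (JsRowD1Pin hLc N) Jc′ μ ν` in place of (SDF-Σ)(JsRowD1Pin, Jc′). -/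
theorem d1Drift_JsRowD1Pin_of_auxiliary_sdInvisible_D1Rep (hLc : Odd Lc) (hL2 : 2 ≤ Lc) (N : ℕ)
    (a : ℝ) (ha : 0 < a)
    (h12 : B5.Prop12Printed (fam (fun i : ℕ+ × ℕ => ((i.1 : ℕ+) : ℕ)) (fun i => i.1.pos) MvE a ha))
    (h126 : B5.Kernel126_127Printed (kfam (fun i : ℕ+ × ℕ => ((i.1 : ℕ+) : ℕ)) MvE))
    {SL : Finset L} (hSL : SL.Nonempty) (k : L → Fin 4) {μ ν : Fin 4} (hμν : μ ≠ ν) {Nc : ℝ} (hNc : Nc ≠ 0)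
    (Jc' : ∀ m : ℕ, JetData 3 (Lc ^ m))
    (h𝒯0' : ∀ m, 1 ≤ m → ∀ c e : Fin 4, HasSum (TshotOf Lc Jc' m c e) 0)
    (h𝒯1' : ∀ m, 1 ≤ m → ∀ c e ρ : Fin 4, HasSum (fun t : Fin 4 → ℤ => t ρ • TshotOf Lc Jc' m c e t) 0)
    (hbase' : TshotOf Lc Jc' 1 = TbalOf Lc (JsRowD1Pin hLc N) 0)
    (hSF' : SDInvisible Lc (JsRowD1Pin hLc N) Jc' μ ν)
    {cc : ℝ} {M : ℕ → ℕ} (hc : 1 ≤ cc) (hMw : ∀ L : ℕ, 2 ≤ L → 1 ≤ M L ∧ (L : ℝ) ≤ cc * M L) (hML : ∀ L : ℕ, 2 ≤ L → M L ≤ L)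
    (hrep' : D1Rep Lc Jc' Nc μ ν a SL k) :
    D1Drift Lc (JsRowD1Pin hLc N) Nc μ ν :=
  d1Drift_JsRowD1Pin_of_auxiliary_D1Rep hLc hL2 N a ha h12 h126 hSL k hμν hNc Jc' h𝒯0' h𝒯1' hbase'
    ⟨0, fun m _ => by rw [Finset.sum_eq_zero fun j hj => hSF' j (Finset.mem_Ico.1 hj).1, abs_zero]⟩ hc hMw hML hrep'

end Summit.QuantumFields.BalabanUV.Beta.RowD1AuxiliaryExchange
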